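import Summits.QuantumFields.YangMills.Theorems.FradkinShenkerFlowSusceptibilityToPoincareLocalPoincareSmallCylinders

/-!
# Stub `stub_linkSetPoincare` of the line `planted-link-pinning` (crux `SusceptibilityToPoincare`)

Route `FradkinShenkerFlow` of `YangMills`, crux item `stmt-QuantumFields-9441`
(`Summit.QuantumFields.YangMills.Theses.FradkinShenkerFlow.SusceptibilityToPoincare`, FS ⇒ UP).
This file proves stub S3c `stub_linkSetPoincare` of the line `planted-link-pinning`:
**the residual variance of `F` given all links OUTSIDE a finite link set `D` is at most
`A · B^{#D}` times the single-link heat-bath Dirichlet contributions of the links IN `D`**, with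
`A ≥ 0`, `B ≥ 1` depending on `(G, r, β)` only — uniformly in the volume `S` and in `D`.
For the 4D torus of side `2S+1`, the Wilson measure `μ = wilsonMeasure r.ρ β` and a bounded
measurable `F`,

  `∫ (F − μ[F | 𝓕_{Dᶜ}])² dμ ≤ ½ e^{c₂} · (e^{2c₂})^{#D} Σ_{ℓ ∈ D} ∫∫ (F U − F(U[ℓ ↦ g]))² dν_ℓ^U(g) dμ(U)`,

`ν_ℓ^U = Haar.tilted (−β S_W(U[ℓ ↦ ·]))` the one-link heat-bath law and
`c₂ = |β| · 2 · (5 · #{planes}) (N + M_t)`, `M_t = sup |Re tr r.ρ|`.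

## Proof

This is the landed `LocalPoincare.integral_sub_condExp_sq_le`
(`FradkinShenkerFlowSusceptibilityToPoincareLocalPoincareSmallCylinders`) with the cylinder's
link set replaced by an arbitrary finset `D`; the cylinder entered there only through the
cardinality of its link set, i.e. through the oscillation constant
`c₁ = |β| · 2 · (#D · 5 · #{planes}) (N + M_t) = #D · c₂` of the tilt of the `D`-kernel.

* *Conditional variance = averaged kernel variance.* The torus Wilson state is a DLR state of the
  plaquette specification `γ` (`exists_plaquettePotential`, `isGibbsMeasure_wilsonMeasure`), so
  the kernel average `m = γ_D F` is a version of `μ[F | 𝓕_{Dᶜ}]`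
  (`IsGibbsMeasure.condExp_ae_eq_integral`); by the DLR equation
  `∫ (F − m)² dμ = ∫∫ (F σ − m σ)² dγ_D(·|η) dμ(η)`, and `m σ = m η` for `γ_D(·|η)`-a.e. `σ`
  (properness and locality of `m`, `dependsOn_integral_gibbsSpecOfPotential`).
* *Inside one kernel* (`LocalPoincare.integral_sub_sq_kernel_le`): Holley–Stroock against glued
  product Haar measure + Efron–Stein, the tilt `−β H_D` oscillating by at most `c₁` over glued
  configurations (`dependsOn_hamiltonianIn_sub`, `LocalPoincare.abs_wilsonAction_sub_le`).
* *DLR backwards and Haar → heat bath* (`HaarResample.integral_haar_le_exp_mul_integral_heatBath`):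
  Haar resampling of one link costs at most `e^{c₂}` times heat-bath resampling.
* *Bookkeeping*: `e^{c₁} e^{c₁} = e^{#D · 2c₂} = (e^{2c₂})^{#D}` (`Real.exp_nat_mul`).
-/

noncomputable section

open MeasureTheory ProbabilityTheory
open Literature.MathematicalPhysics.QuantumFieldTheory
open Literature.Probability.LatticeModels
open Literature.MathematicalPhysics.QuantumLattice (exists_plaquettePotential
  isGibbsMeasure_wilsonMeasure dependsOn_integral_gibbsSpecOfPotential)

namespace Summit.QuantumFields.YangMills.Theorems.SusceptibilityToPoincare

namespace LinkSetPoincare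

/-! ### The torus Wilson measure: local Poincaré inequality for an arbitrary finite link set -/

section Torus

variable {G : Type} [Group G] [TopologicalSpace G] [IsTopologicalGroup G] [CompactSpace G]
  [MeasurableSpace G] [BorelSpace G]

/-- **Residual variance given the links off a finite link set, uniformly in the volume and in
the exterior** (explicit constant). For the torus Wilson measure `μ = wilsonMeasure r.ρ β` on
`(ℤ/(2S+1))⁴`, a finite link set `D`, and a measurable `F` with `|F| ≤ M`:
`E_μ(F − E_μ[F | links outside D])² ≤ ½ e^{c₂} (e^{2c₂})^{#D} Σ_{ℓ ∈ D} ∫∫ (F U − F(U[ℓ ↦ g]))² dν_ℓ^U(g) dμ(U)`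
with `c₂ = |β| · 2 · (5 · #{planes}) (N + M_t)`.
Proof: the conditional expectation is the kernel average of the plaquette specification
(`isGibbsMeasure_wilsonMeasure`, `IsGibbsMeasure.condExp_ae_eq_integral`); by the DLR equation and
properness the conditional variance is the `μ`-average of the kernel variances; inside a kernel,
Holley–Stroock against glued product Haar measure and Efron–Stein
(`LocalPoincare.integral_sub_sq_kernel_le`, oscillation of the tilt = oscillation of the Wilson
action `≤ #D · c₂`, `LocalPoincare.abs_wilsonAction_sub_le`); DLR backwards; Haar resampling of
one link is dominated by heat-bath resampling
(`HaarResample.integral_haar_le_exp_mul_integral_heatBath`). [folklore] -/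
theorem integral_sub_condExp_sq_le (r : LatticeRep G) (β : ℝ) {Mt : ℝ} (hMt0 : 0 ≤ Mt)
    (hMt : ∀ g, |(r.ρ g).trace.re| ≤ Mt) (S : ℕ) (D : Finset (Edge 4 (2 * S + 1)))
    {F : GaugeConfig 4 (2 * S + 1) G → ℝ} (hF : Measurable F) {M : ℝ} (hM : ∀ U, |F U| ≤ M) :
    ∫ U, (F U - ((wilsonMeasure r.ρ β : Measure (GaugeConfig 4 (2 * S + 1) G))[F|
        cylinderEvents ((↑D : Set (Edge 4 (2 * S + 1)))ᶜ)]) U) ^ 2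
        ∂(wilsonMeasure r.ρ β : Measure (GaugeConfig 4 (2 * S + 1) G)) ≤
      (1 / 2 : ℝ) * Real.exp (|β| * (2 * ((((4 + 1) *
          Fintype.card {q : Fin 4 × Fin 4 // q.1 < q.2} : ℕ) : ℝ) * ((r.N : ℝ) + Mt)))) *
        Real.exp (2 * (|β| * (2 * ((((4 + 1) *
          Fintype.card {q : Fin 4 × Fin 4 // q.1 < q.2} : ℕ) : ℝ) * ((r.N : ℝ) + Mt))))) ^ D.card *
      ∑ ℓ ∈ D, ∫ U, ∫ g, (F U - F (Function.update U ℓ g)) ^ 2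
          ∂((haarProbability G).tilted (fun g' => -β * wilsonAction r.ρ (Function.update U ℓ g')))
          ∂(wilsonMeasure r.ρ β : Measure (GaugeConfig 4 (2 * S + 1) G)) := by
  classical
  haveI : SecondCountableTopology G :=
    (r.continuous.isClosedEmbedding r.injective).isEmbedding.secondCountableTopology
  haveI : T2Space G := (r.continuous.isClosedEmbedding r.injective).isEmbedding.t2Space
  set μ : Measure (GaugeConfig 4 (2 * S + 1) G) := wilsonMeasure r.ρ β with hμdef
  haveI : IsProbabilityMeasure μ :=
    isProbabilityMeasure_wilsonMeasure (d := 4) (L := 2 * S + 1) r.ρ r.continuous β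
  set P : ℕ := Fintype.card {q : Fin 4 × Fin 4 // q.1 < q.2} with hP
  set c₁ : ℝ := |β| * (2 * (((D.card * (4 + 1) * P : ℕ) : ℝ) * ((r.N : ℝ) + Mt))) with hc₁
  set c₂ : ℝ := |β| * (2 * ((((4 + 1) * P : ℕ) : ℝ) * ((r.N : ℝ) + Mt))) with hc₂
  set hb : Edge 4 (2 * S + 1) → ℝ := fun ℓ => ∫ U, ∫ g, (F U - F (Function.update U ℓ g)) ^ 2
    ∂((haarProbability G).tilted (fun g' => -β * wilsonAction r.ρ (Function.update U ℓ g'))) ∂μ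
    with hhb
  -- bookkeeping of the constants: `e^{c₁} e^{c₁} = (e^{2 c₂})^{#D}`
  have hexp : Real.exp c₁ * Real.exp c₁ = Real.exp (2 * c₂) ^ D.card := by
    rw [← Real.exp_add, ← Real.exp_nat_mul]
    congr 1
    rw [hc₁, hc₂]
    push_cast
    ring
  -- the Gibbs structure of `μ`
  obtain ⟨Φ, supp, hΦ, hΦb, hsupp, hH, -⟩ :=
    exists_plaquettePotential (d := 4) (L := 2 * S + 1) r.ρ r.continuous
  set γ : Specification (Edge 4 (2 * S + 1)) G :=
    gibbsSpecOfPotential (haarProbability G) Φ supp β with hγdef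
  have hγ : IsSpecification γ :=
    isSpecification_gibbsSpecOfPotential (haarProbability G) hΦ hΦb hsupp β
  have hGibbs : IsGibbsMeasure γ μ :=
    isGibbsMeasure_wilsonMeasure r.ρ r.continuous hΦ hΦb hsupp hH β
  haveI hγprob : ∀ η, IsProbabilityMeasure (γ D η) := fun η => hγ.isProbability D η
  let κk : Kernel (GaugeConfig 4 (2 * S + 1) G) (GaugeConfig 4 (2 * S + 1) G) :=
    ⟨γ D, hγ.measurable_fun D⟩
  -- the tilt of the `D`-kernel: bounded, measurable, oscillation `≤ c₁` over glued configurations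
  set φD : GaugeConfig 4 (2 * S + 1) G → ℝ := fun σ => -β * hamiltonianIn Φ supp D σ with hφD
  have hφm : Measurable φD := (measurable_hamiltonianIn (fun A => (hΦ A).2) supp D).const_mul _
  have hφb : ∃ A, ∀ σ, |φD σ| ≤ A := by
    choose C hC using hΦb
    refine ⟨|β| * ∑ A ∈ supp D with (A ∩ D).Nonempty, C A, fun σ => ?_⟩
    rw [hφD, abs_mul, abs_neg]
    exact mul_le_mul_of_nonneg_left (abs_hamiltonianIn_le hC supp D σ) (abs_nonneg β)
  have hosc : ∀ (η : GaugeConfig 4 (2 * S + 1) G) (ζ ζ' : D → G),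
      φD (glueWith D ζ' η) ≤ φD (glueWith D ζ η) + c₁ := by
    intro η ζ ζ'
    have hagree : ∀ e, e ∉ D → glueWith D ζ' η e = glueWith D ζ η e := fun e he => by
      rw [glueWith_apply_not_mem _ _ _ he, glueWith_apply_not_mem _ _ _ he]
    have hdep : hamiltonianIn Φ supp Finset.univ (glueWith D ζ' η) -
        hamiltonianIn Φ supp D (glueWith D ζ' η) =
        hamiltonianIn Φ supp Finset.univ (glueWith D ζ η) -
        hamiltonianIn Φ supp D (glueWith D ζ η) :=
      dependsOn_hamiltonianIn_sub hΦ hsupp (Finset.subset_univ D)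
        (fun e he => hagree e (fun h => he (Finset.mem_coe.2 h)))
    rw [hH, hH] at hdep
    have hW : |wilsonAction r.ρ (glueWith D ζ' η) - wilsonAction r.ρ (glueWith D ζ η)| ≤
        2 * (((D.card * (4 + 1) * P : ℕ) : ℝ) * ((r.N : ℝ) + Mt)) :=
      LocalPoincare.abs_wilsonAction_sub_le r.ρ hMt D hagree
    have hkey : φD (glueWith D ζ' η) - φD (glueWith D ζ η) =
        -β * (wilsonAction r.ρ (glueWith D ζ' η) - wilsonAction r.ρ (glueWith D ζ η)) := by
      rw [hφD]
      linear_combination β * hdep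
    have hle : φD (glueWith D ζ' η) - φD (glueWith D ζ η) ≤ c₁ := by
      rw [hkey]
      calc -β * (wilsonAction r.ρ (glueWith D ζ' η) - wilsonAction r.ρ (glueWith D ζ η))
          ≤ |-β * (wilsonAction r.ρ (glueWith D ζ' η) - wilsonAction r.ρ (glueWith D ζ η))| :=
            le_abs_self _
        _ = |β| * |wilsonAction r.ρ (glueWith D ζ' η) - wilsonAction r.ρ (glueWith D ζ η)| := by
            rw [abs_mul, abs_neg]
        _ ≤ |β| * (2 * (((D.card * (4 + 1) * P : ℕ) : ℝ) * ((r.N : ℝ) + Mt))) :=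
            mul_le_mul_of_nonneg_left hW (abs_nonneg β)
        _ = c₁ := by rw [hc₁]
    linarith
  -- the kernel average `mF` of `F`: a version of the conditional expectation, local, bounded
  set mF : GaugeConfig 4 (2 * S + 1) G → ℝ := fun η => ∫ σ, F σ ∂(γ D η) with hmF
  have hcond : μ[F|cylinderEvents (X := fun _ : Edge 4 (2 * S + 1) => G)
      ((↑D : Set (Edge 4 (2 * S + 1)))ᶜ)] =ᵐ[μ] mF :=
    hGibbs.condExp_ae_eq_integral hγ D hF hM
  have hmFm : Measurable mF := (hF.stronglyMeasurable.integral_kernel (κ := κk)).measurable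
  have hmFb : ∀ η, |mF η| ≤ M := fun η => by
    have := norm_integral_le_of_norm_le_const (μ := γ D η) (C := M) (f := F)
      (ae_of_all _ fun σ => by rw [Real.norm_eq_abs]; exact hM σ)
    simpa only [Real.norm_eq_abs, probReal_univ, mul_one] using this
  have hmFdep : DependsOn mF ((↑D : Set (Edge 4 (2 * S + 1)))ᶜ) :=
    dependsOn_integral_gibbsSpecOfPotential (haarProbability G) hΦ supp β D
      (T := ((↑D : Set (Edge 4 (2 * S + 1)))ᶜ))
      (fun A _ _ => by rw [Set.union_compl_self]; exact Set.subset_univ _)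
      hF.stronglyMeasurable (by rw [Set.union_compl_self]; exact dependsOn_univ F)
  -- the Haar resampling costs `Ψ i σ = ∫ (F σ − F(σ[i ↦ y]))² dHaar(y)`
  set Ψ : D → GaugeConfig 4 (2 * S + 1) G → ℝ := fun i σ =>
    ∫ y, (F σ - F (Function.update σ (↑i) y)) ^ 2 ∂(haarProbability G) with hΨ
  have hDm : ∀ i : D, Measurable fun q : GaugeConfig 4 (2 * S + 1) G × G =>
      (F q.1 - F (Function.update q.1 (↑i) q.2)) ^ 2 :=
    fun i => ((hF.comp measurable_fst).sub (hF.comp measurable_update')).pow_const 2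
  have hΨm : ∀ i, Measurable (Ψ i) := fun i =>
    ((hDm i).stronglyMeasurable.integral_prod_right' (ν := haarProbability G)).measurable
  have hΨ0 : ∀ i σ, 0 ≤ Ψ i σ := fun i σ => integral_nonneg fun _ => sq_nonneg _
  have hΨB : ∀ i σ, Ψ i σ ≤ (2 * M) ^ 2 := fun i σ => by
    have := norm_integral_le_of_norm_le_const (μ := haarProbability G) (C := (2 * M) ^ 2)
      (f := fun y => (F σ - F (Function.update σ (↑i) y)) ^ 2)
      (ae_of_all _ fun y => OrbitES.norm_sq_sub_le (hM _) (hM _))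
    rw [probReal_univ, mul_one, Real.norm_eq_abs, abs_of_nonneg (hΨ0 i σ)] at this
    exact this
  have hΨint : ∀ i, Integrable (Ψ i) μ := fun i =>
    Integrable.of_bound (hΨm i).aestronglyMeasurable ((2 * M) ^ 2)
      (ae_of_all _ fun σ => by rw [Real.norm_eq_abs, abs_of_nonneg (hΨ0 i σ)]; exact hΨB i σ)
  have hΨki : ∀ i, Integrable (fun η => ∫ σ, Ψ i σ ∂(γ D η)) μ := fun i =>
    Integrable.of_bound ((hΨm i).stronglyMeasurable.integral_kernel (κ := κk)).aestronglyMeasurable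
      ((2 * M) ^ 2) (ae_of_all _ fun η => by
        have := norm_integral_le_of_norm_le_const (μ := γ D η) (C := (2 * M) ^ 2) (f := Ψ i)
          (ae_of_all _ fun σ => by rw [Real.norm_eq_abs, abs_of_nonneg (hΨ0 i σ)]; exact hΨB i σ)
        simpa only [probReal_univ, mul_one] using this)
  -- STEP 2 (inside one kernel): Holley–Stroock + Efron–Stein
  have hker : ∀ η, ∫ σ, (F σ - mF η) ^ 2 ∂(γ D η) ≤
      Real.exp c₁ * Real.exp c₁ * (1 / 2 : ℝ) * ∑ i : D, ∫ σ, Ψ i σ ∂(γ D η) := fun η =>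
    LocalPoincare.integral_sub_sq_kernel_le (haarProbability G) D η hφm hφb (hosc η) hF hM
  -- STEP 1 (conditional variance = averaged kernel variance) and STEP 3 (DLR backwards)
  have hinner : ∀ η, ∫ σ, (F σ - mF σ) ^ 2 ∂(γ D η) = ∫ σ, (F σ - mF η) ^ 2 ∂(γ D η) :=
    fun η => by
      refine integral_congr_ae ?_
      filter_upwards [hγ.proper D η] with σ hσ
      rw [hmFdep (fun e he => hσ e (fun h => he (Finset.mem_coe.2 h)))]
  have hint1 : Integrable (fun σ => (F σ - mF σ) ^ 2) μ :=
    Integrable.of_bound ((hF.sub hmFm).pow_const 2).aestronglyMeasurable ((2 * M) ^ 2)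
      (ae_of_all _ fun σ => OrbitES.norm_sq_sub_le (hM σ) (hmFb σ))
  have hRi : Integrable (fun η => Real.exp c₁ * Real.exp c₁ * (1 / 2 : ℝ) *
      ∑ i : D, ∫ σ, Ψ i σ ∂(γ D η)) μ :=
    (integrable_finsetSum _ fun i _ => hΨki i).const_mul _
  -- STEP 4 (Haar → heat bath, per link)
  have hlink : ∀ i : D, ∫ σ, Ψ i σ ∂μ ≤ Real.exp c₂ * hb ↑i := fun i =>
    HaarResample.integral_haar_le_exp_mul_integral_heatBath r β hMt0 hMt S hF hM ↑i
  have hK0 : 0 ≤ Real.exp c₁ * Real.exp c₁ * (1 / 2 : ℝ) := by positivity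
  calc ∫ U, (F U - (μ[F|cylinderEvents (X := fun _ : Edge 4 (2 * S + 1) => G)
          ((↑D : Set (Edge 4 (2 * S + 1)))ᶜ)]) U) ^ 2 ∂μ
      = ∫ U, (F U - mF U) ^ 2 ∂μ :=
        integral_congr_ae (by filter_upwards [hcond] with U hU; rw [hU])
    _ = ∫ η, ∫ σ, (F σ - mF σ) ^ 2 ∂(γ D η) ∂μ := (hGibbs.integral_integral_eq hγ D hint1).symm
    _ = ∫ η, ∫ σ, (F σ - mF η) ^ 2 ∂(γ D η) ∂μ := integral_congr_ae (ae_of_all _ hinner)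
    _ ≤ ∫ η, Real.exp c₁ * Real.exp c₁ * (1 / 2 : ℝ) * ∑ i : D, ∫ σ, Ψ i σ ∂(γ D η) ∂μ :=
        integral_mono_of_nonneg (ae_of_all _ fun η => integral_nonneg fun _ => sq_nonneg _) hRi
          (ae_of_all _ hker)
    _ = Real.exp c₁ * Real.exp c₁ * (1 / 2 : ℝ) * ∑ i : D, ∫ η, ∫ σ, Ψ i σ ∂(γ D η) ∂μ := by
        rw [integral_const_mul, integral_finsetSum _ fun i _ => hΨki i]
    _ = Real.exp c₁ * Real.exp c₁ * (1 / 2 : ℝ) * ∑ i : D, ∫ σ, Ψ i σ ∂μ := by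
        congr 1
        exact Finset.sum_congr rfl fun i _ => hGibbs.integral_integral_eq hγ D (hΨint i)
    _ ≤ Real.exp c₁ * Real.exp c₁ * (1 / 2 : ℝ) * ∑ i : D, Real.exp c₂ * hb ↑i :=
        mul_le_mul_of_nonneg_left (Finset.sum_le_sum fun i _ => hlink i) hK0
    _ = Real.exp c₁ * Real.exp c₁ * ((1 / 2 : ℝ) * Real.exp c₂ * ∑ i : D, hb ↑i) := by
        rw [← Finset.mul_sum]; ring
    _ = (1 / 2 : ℝ) * Real.exp c₂ * Real.exp (2 * c₂) ^ D.card * ∑ ℓ ∈ D, hb ℓ := by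
        rw [Finset.sum_coe_sort D hb, hexp]; ring

end Torus

end LinkSetPoincare

/-! ### The registered stub -/

/-- `stub_linkSetPoincare` — **S3c · residual variance given the links off a finite link set**
(stub of the line `planted-link-pinning`; TRUE for every compact `G`, real `β`). There are
`A ≥ 0`, `B ≥ 1` depending on `G, r, β` only (namely `A = ½ e^{c₂}`, `B = e^{2c₂}` with
`c₂ = |β| · 2 · (5 · #{planes}) (N + M_t)`, `M_t = sup |Re tr r.ρ|`) such that on every torus
`(ℤ/(2S+1))⁴`, for every finite link set `D` and every bounded measurable `F`:
`E_μ(F − E_μ[F | links outside D])² ≤ A · B^{#D} · Σ_{ℓ ∈ D} ∫∫ (F U − F(U[ℓ ↦ g]))² dν_ℓ^U(g) dμ(U)`,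
`μ = wilsonMeasure r.ρ β`, `ν_ℓ^U = Haar.tilted (−β S_W(U[ℓ ↦ ·]))` the one-link heat-bath law
(`LinkSetPoincare.integral_sub_condExp_sq_le`: DLR kernel of `D` as the conditional expectation,
Holley–Stroock + Efron–Stein inside the kernel, Haar → heat-bath resampling). [folklore] -/
theorem stub_linkSetPoincare :
    ∀ (G : Type) [Group G] [TopologicalSpace G] [IsTopologicalGroup G] [CompactSpace G]
      [MeasurableSpace G] [BorelSpace G] (r : LatticeRep G) (β : ℝ), ∃ A B : ℝ, 0 ≤ A ∧ 1 ≤ B ∧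
      ∀ (S : ℕ) (μW : Measure (GaugeConfig 4 (2 * S + 1) G)),
      μW = (wilsonMeasure r.ρ β : Measure (GaugeConfig 4 (2 * S + 1) G)) →
      ∀ (D : Finset (Edge 4 (2 * S + 1))) (F : GaugeConfig 4 (2 * S + 1) G → ℝ),
      Measurable F → (∃ M : ℝ, ∀ U, |F U| ≤ M) →
      ∫ U, (F U - (μW[F | cylinderEvents ((↑D : Set (Edge 4 (2 * S + 1)))ᶜ)]) U) ^ 2 ∂μW ≤
        A * B ^ D.card * ∑ ℓ ∈ D, ∫ U, ∫ g, (F U - F (Function.update U ℓ g)) ^ 2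
          ∂((haarProbability G).tilted (fun g' => -β * wilsonAction r.ρ (Function.update U ℓ g'))) ∂μW := by
  intro G _ _ _ _ _ _ r β
  obtain ⟨Mt, hMt0, hMt⟩ := exists_bound_trace_re_nonneg r.ρ r.continuous
  refine ⟨(1 / 2 : ℝ) * Real.exp (|β| * (2 * ((((4 + 1) *
      Fintype.card {q : Fin 4 × Fin 4 // q.1 < q.2} : ℕ) : ℝ) * ((r.N : ℝ) + Mt)))),
    Real.exp (2 * (|β| * (2 * ((((4 + 1) *
      Fintype.card {q : Fin 4 × Fin 4 // q.1 < q.2} : ℕ) : ℝ) * ((r.N : ℝ) + Mt))))),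
    by positivity, Real.one_le_exp (by positivity), fun S μW hμW D F hF hbd => ?_⟩
  obtain ⟨M, hM⟩ := hbd
  subst hμW
  exact LinkSetPoincare.integral_sub_condExp_sq_le r β hMt0 hMt S D hF hM

end Summit.QuantumFields.YangMills.Theorems.SusceptibilityToPoincare

end
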